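import Summits.AtomisticToContinuum.Crystallization.Theorems.ExcessDecayLiouvilleHcpLiouvilleBlowdownDefs

/-!
# `ExcessDecayLiouville.HcpLiouville` (stmt-AtomisticToContinuum-9332), line `Sketch`, skeleton v4: the blow-down iteration

Stub `stub_iteration` of the skeleton (crux `HcpLiouville`, rank 3, line `Sketch`, v4): the final, purely
real-analytic step of the blow-down Liouville argument.  An improvement-of-flatness step
`Blowdown.ImprovementProp θ R₀ K S v` valid at every scale `R ≥ R₀` (the normalised mean-square oscillation at
scale `θR` is at most half the one at scale `16R`, up to the floor `K R⁻⁴`), applied to a BOUNDED field `v` on a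
locally finite site set `S` with the packing bound `#(S ∩ B_r) ≤ 32 r³` (`r ≥ 1`) and covering radius `2`, forces
`v` to be constant: boundedness is smallness at `R = ∞`, so `n` steps of the ladder started at scale `(16/θ)ⁿ ρ`
with the constant `0` give `ρ⁻³ · osc(ρ) ≤ 2⁻ⁿ · 32 · (3/40)² + 2 K⁺ θ⁴ ρ⁻⁴` (`iterate_bound`), hence the
oscillation on every fixed ball is arbitrarily small (`exists_oscAt_lt`), hence `v` is constant on every ball of
radius `3` (`eq_of_dist_le_three`), hence constant (`eq_of_chain`, chaining balls along a segment through the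
covering radius).  No Lennard-Jones, no lattice.  All `[folklore]`; a `--supports` helper for item
stmt-AtomisticToContinuum-9332, closing nothing.
-/

noncomputable section

namespace Summit.AtomisticToContinuum.Crystallization.Theorems.ExcessDecayLiouville

open scoped BigOperators Topology Classical InnerProductSpace RealInnerProductSpace
open Filter
open Literature.MathematicalPhysics.StatisticalMechanics
open Summit.AtomisticToContinuum.Crystallization.Theses.ExcessDecayLiouville
open Summit.AtomisticToContinuum.Crystallization.Theorems.PhononStabilityNegative

namespace Blowdown

section Iteration

variable {S : Set (EuclideanSpace ℝ (Fin 3))} {v : EuclideanSpace ℝ (Fin 3) → EuclideanSpace ℝ (Fin 3)}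

/-- The oscillation functional is a finite sum over the sites of the closed ball. [folklore] -/
theorem oscAt_eq_sum (c : EuclideanSpace ℝ (Fin 3)) (r : ℝ) (m : EuclideanSpace ℝ (Fin 3))
    (hF : Set.Finite {s : EuclideanSpace ℝ (Fin 3) | s ∈ S ∧ dist s c ≤ r}) :
    oscAt S v c r m = ∑ s ∈ hF.toFinset, ‖v s - m‖ ^ 2 := by
  rw [oscAt, ← Finset.tsum_subtype]
  exact tsum_congr_subtype (fun s => ‖v s - m‖ ^ 2) fun x => by
    rw [Set.Finite.mem_toFinset, Set.mem_setOf_eq]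

/-- A single term is bounded by the oscillation. [folklore] -/
theorem norm_sub_sq_le_oscAt {c : EuclideanSpace ℝ (Fin 3)} {r : ℝ}
    (hF : Set.Finite {s : EuclideanSpace ℝ (Fin 3) | s ∈ S ∧ dist s c ≤ r})
    {s : EuclideanSpace ℝ (Fin 3)} (hs : s ∈ S) (hsc : dist s c ≤ r) (m : EuclideanSpace ℝ (Fin 3)) :
    ‖v s - m‖ ^ 2 ≤ oscAt S v c r m := by
  rw [oscAt_eq_sum c r m hF]
  exact Finset.single_le_sum (f := fun x => ‖v x - m‖ ^ 2) (fun _ _ => sq_nonneg _)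
    (hF.mem_toFinset.2 ⟨hs, hsc⟩)

/-- The oscillation about a fixed constant is monotone in the radius. [folklore] -/
theorem oscAt_mono
    (hfin : ∀ (c : EuclideanSpace ℝ (Fin 3)) (r : ℝ),
      Set.Finite {s : EuclideanSpace ℝ (Fin 3) | s ∈ S ∧ dist s c ≤ r})
    (c : EuclideanSpace ℝ (Fin 3)) {r r' : ℝ} (h : r ≤ r') (m : EuclideanSpace ℝ (Fin 3)) :
    oscAt S v c r m ≤ oscAt S v c r' m := by
  rw [oscAt_eq_sum c r m (hfin c r), oscAt_eq_sum c r' m (hfin c r')]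
  refine Finset.sum_le_sum_of_subset_of_nonneg (fun s hs => ?_) fun _ _ _ => sq_nonneg _
  rw [Set.Finite.mem_toFinset, Set.mem_setOf_eq] at hs ⊢
  exact ⟨hs.1, hs.2.trans h⟩

/-- The crude bound at the top of the ladder: about the constant `0`, a field bounded by `3/40` on a set with
at most `32 r³` sites per `r`-ball has oscillation `≤ 32 r³ (3/40)²` (`r ≥ 1`). [folklore] -/
theorem oscAt_zero_le
    (hfin : ∀ (c : EuclideanSpace ℝ (Fin 3)) (r : ℝ),
      Set.Finite {s : EuclideanSpace ℝ (Fin 3) | s ∈ S ∧ dist s c ≤ r})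
    (hcard : ∀ (c : EuclideanSpace ℝ (Fin 3)) (r : ℝ), 1 ≤ r → ∀ F : Finset (EuclideanSpace ℝ (Fin 3)),
      (∀ s ∈ F, s ∈ S ∧ dist s c ≤ r) → (F.card : ℝ) ≤ 32 * r ^ 3)
    (hbd : ∀ s ∈ S, ‖v s‖ ≤ 3 / 40) (c : EuclideanSpace ℝ (Fin 3)) {r : ℝ} (hr : 1 ≤ r) :
    oscAt S v c r 0 ≤ 32 * r ^ 3 * (3 / 40) ^ 2 := by
  rw [oscAt_eq_sum c r 0 (hfin c r)]
  have hmem : ∀ s ∈ (hfin c r).toFinset, s ∈ S ∧ dist s c ≤ r := fun s hs => by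
    simpa only [Set.Finite.mem_toFinset, Set.mem_setOf_eq] using hs
  calc ∑ s ∈ (hfin c r).toFinset, ‖v s - 0‖ ^ 2 ≤ (hfin c r).toFinset.card • ((3 / 40 : ℝ) ^ 2) :=
      Finset.sum_le_card_nsmul _ _ _ fun s hs => by
        rw [sub_zero]
        exact pow_le_pow_left₀ (norm_nonneg _) (hbd s (hmem s hs).1) 2
    _ = ((hfin c r).toFinset.card : ℝ) * (3 / 40) ^ 2 := nsmul_eq_mul _ _
    _ ≤ 32 * r ^ 3 * (3 / 40) ^ 2 := by
      gcongr
      exact hcard c r hr _ hmem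

/-- **The ladder.** `n` improvement steps started at scale `(16/θ)ⁿ ρ` with the constant `0`: for
`ρ ≥ max (θR₀) 1` some constant `‖m'‖ ≤ 1` has
`ρ⁻³ · oscAt S v c ρ m' ≤ 2⁻ⁿ · 32 · (3/40)² + 2 K⁺ θ⁴ ρ⁻⁴` (`K⁺ = max K 0`; the floors sum geometrically).
[folklore] -/
theorem iterate_bound
    (hfin : ∀ (c : EuclideanSpace ℝ (Fin 3)) (r : ℝ),
      Set.Finite {s : EuclideanSpace ℝ (Fin 3) | s ∈ S ∧ dist s c ≤ r})
    (hcard : ∀ (c : EuclideanSpace ℝ (Fin 3)) (r : ℝ), 1 ≤ r → ∀ F : Finset (EuclideanSpace ℝ (Fin 3)),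
      (∀ s ∈ F, s ∈ S ∧ dist s c ≤ r) → (F.card : ℝ) ≤ 32 * r ^ 3)
    (hbd : ∀ s ∈ S, ‖v s‖ ≤ 3 / 40) {θ R₀ K : ℝ} (hθ : 0 < θ) (hθ1 : θ < 1)
    (hIP : ImprovementProp θ R₀ K S v) (c : EuclideanSpace ℝ (Fin 3)) (n : ℕ) :
    ∀ ρ : ℝ, θ * R₀ ≤ ρ → 1 ≤ ρ → ∃ m' : EuclideanSpace ℝ (Fin 3), ‖m'‖ ≤ 1 ∧
      (ρ⁻¹) ^ 3 * oscAt S v c ρ m' ≤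
        (1 / 2) ^ n * (32 * (3 / 40) ^ 2) + 2 * max K 0 * θ ^ 4 * (ρ⁻¹) ^ 4 := by
  induction n with
  | zero =>
    intro ρ _ hρ1
    have hρ0 : 0 < ρ := by linarith
    refine ⟨0, by simp, ?_⟩
    have h1 : (ρ⁻¹) ^ 3 * oscAt S v c ρ 0 ≤ 32 * (3 / 40) ^ 2 := by
      rw [inv_pow, inv_mul_le_iff₀ (by positivity)]
      calc oscAt S v c ρ 0 ≤ 32 * ρ ^ 3 * (3 / 40) ^ 2 := oscAt_zero_le hfin hcard hbd c hρ1
        _ = ρ ^ 3 * (32 * (3 / 40) ^ 2) := by ring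
    have h2 : 0 ≤ 2 * max K 0 * θ ^ 4 * (ρ⁻¹) ^ 4 := by positivity
    rw [pow_zero, one_mul]
    linarith
  | succ n ih =>
    intro ρ hρ hρ1
    have hρ0 : 0 < ρ := by linarith
    have hθR : θ * (ρ / θ) = ρ := by field_simp
    have hρR : ρ ≤ ρ / θ := by
      rw [le_div_iff₀ hθ]
      nlinarith
    have hR16 : ρ ≤ 16 * (ρ / θ) := by linarith
    have hR₀R : R₀ ≤ ρ / θ := by
      rw [le_div_iff₀ hθ]
      linarith
    obtain ⟨m, hm, hmb⟩ := ih (16 * (ρ / θ)) (hρ.trans hR16) (hρ1.trans hR16)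
    obtain ⟨m', hm', hstep⟩ := hIP c (ρ / θ) m hR₀R hm
    refine ⟨m', hm', ?_⟩
    rw [hθR] at hstep
    have hK : K ≤ max K 0 := le_max_left _ _
    have hRinv : ((ρ / θ)⁻¹) ^ 4 = θ ^ 4 * (ρ⁻¹) ^ 4 := by
      rw [inv_div, div_pow, inv_pow, div_eq_mul_inv]
    have h16 : ((16 * (ρ / θ))⁻¹) ^ 4 ≤ (ρ⁻¹) ^ 4 :=
      pow_le_pow_left₀ (by positivity) (inv_anti₀ hρ0 hR16) 4
    have hA : 2 * max K 0 * θ ^ 4 * ((16 * (ρ / θ))⁻¹) ^ 4 ≤ 2 * max K 0 * θ ^ 4 * (ρ⁻¹) ^ 4 :=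
      mul_le_mul_of_nonneg_left h16 (by positivity)
    have hB : K * ((ρ / θ)⁻¹) ^ 4 ≤ max K 0 * (θ ^ 4 * (ρ⁻¹) ^ 4) := by
      rw [hRinv]
      exact mul_le_mul_of_nonneg_right hK (by positivity)
    have hpow : (1 / 2 : ℝ) ^ (n + 1) = 1 / 2 * (1 / 2) ^ n := by ring
    have hX : 0 ≤ ((16 * (ρ / θ))⁻¹) ^ 3 * oscAt S v c (16 * (ρ / θ)) m := by
      have := oscAt_nonneg S v c (16 * (ρ / θ)) m
      positivity
    rw [hpow]
    linarith

/-- **Smallness on a fixed ball.** Under the ladder hypotheses the oscillation on the ball of radius `3` about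
a suitable constant is smaller than any `ε > 0` (choose the scale `ρ` with `2K⁺θ⁴ρ⁻¹ < ε/2`, then the number of
steps `n` with `2⁻ⁿ · 32 (3/40)² ρ³ < ε/2`, and restrict from `B_ρ` to `B_3`). [folklore] -/
theorem exists_oscAt_lt
    (hfin : ∀ (c : EuclideanSpace ℝ (Fin 3)) (r : ℝ),
      Set.Finite {s : EuclideanSpace ℝ (Fin 3) | s ∈ S ∧ dist s c ≤ r})
    (hcard : ∀ (c : EuclideanSpace ℝ (Fin 3)) (r : ℝ), 1 ≤ r → ∀ F : Finset (EuclideanSpace ℝ (Fin 3)),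
      (∀ s ∈ F, s ∈ S ∧ dist s c ≤ r) → (F.card : ℝ) ≤ 32 * r ^ 3)
    (hbd : ∀ s ∈ S, ‖v s‖ ≤ 3 / 40) {θ R₀ K : ℝ} (hθ : 0 < θ) (hθ1 : θ < 1)
    (hIP : ImprovementProp θ R₀ K S v) (c : EuclideanSpace ℝ (Fin 3)) {ε : ℝ} (hε : 0 < ε) :
    ∃ m : EuclideanSpace ℝ (Fin 3), oscAt S v c 3 m < ε := by
  obtain ⟨ρ, hρ, hρε⟩ : ∃ ρ : ℝ, max (θ * R₀) 3 ≤ ρ ∧ 2 * max K 0 * θ ^ 4 * ρ⁻¹ < ε / 2 := by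
    have ht : Tendsto (fun ρ : ℝ => 2 * max K 0 * θ ^ 4 * ρ⁻¹) atTop (𝓝 0) := by
      have := tendsto_inv_atTop_zero.const_mul (2 * max K 0 * θ ^ 4)
      rwa [mul_zero] at this
    exact ((eventually_ge_atTop _).and (ht.eventually_lt_const (by positivity))).exists
  have hρ3 : 3 ≤ ρ := (le_max_right _ _).trans hρ
  have hρθ : θ * R₀ ≤ ρ := (le_max_left _ _).trans hρ
  have hρ0 : 0 < ρ := by linarith
  obtain ⟨n, hn⟩ : ∃ n : ℕ, (1 / 2 : ℝ) ^ n < ε / 2 / (ρ ^ 3 * (32 * (3 / 40) ^ 2)) :=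
    exists_pow_lt_of_lt_one (by positivity) (by norm_num)
  obtain ⟨m, -, hm⟩ := iterate_bound hfin hcard hbd hθ hθ1 hIP c n ρ hρθ (by linarith)
  refine ⟨m, ?_⟩
  rw [inv_pow, inv_mul_le_iff₀ (by positivity)] at hm
  rw [lt_div_iff₀ (by positivity)] at hn
  calc oscAt S v c 3 m ≤ oscAt S v c ρ m := oscAt_mono hfin c hρ3 m
    _ ≤ ρ ^ 3 * ((1 / 2) ^ n * (32 * (3 / 40) ^ 2) + 2 * max K 0 * θ ^ 4 * (ρ⁻¹) ^ 4) := hm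
    _ = (1 / 2) ^ n * (ρ ^ 3 * (32 * (3 / 40) ^ 2)) + 2 * max K 0 * θ ^ 4 * ρ⁻¹ * (ρ * ρ⁻¹) ^ 3 := by
      ring
    _ < ε / 2 + ε / 2 := by
      rw [mul_inv_cancel₀ hρ0.ne', one_pow, mul_one]
      exact add_lt_add hn hρε
    _ = ε := by ring

/-- **Local constancy.** Under the ladder hypotheses `v` is constant on `S ∩ B_3(c)` for every centre `c`:
two sites of the ball are both within `√ε` of the almost-minimising constant, for every `ε > 0`. [folklore] -/
theorem eq_of_dist_le_three
    (hfin : ∀ (c : EuclideanSpace ℝ (Fin 3)) (r : ℝ),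
      Set.Finite {s : EuclideanSpace ℝ (Fin 3) | s ∈ S ∧ dist s c ≤ r})
    (hcard : ∀ (c : EuclideanSpace ℝ (Fin 3)) (r : ℝ), 1 ≤ r → ∀ F : Finset (EuclideanSpace ℝ (Fin 3)),
      (∀ s ∈ F, s ∈ S ∧ dist s c ≤ r) → (F.card : ℝ) ≤ 32 * r ^ 3)
    (hbd : ∀ s ∈ S, ‖v s‖ ≤ 3 / 40) {θ R₀ K : ℝ} (hθ : 0 < θ) (hθ1 : θ < 1)
    (hIP : ImprovementProp θ R₀ K S v) (c : EuclideanSpace ℝ (Fin 3)) {s s' : EuclideanSpace ℝ (Fin 3)}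
    (hs : s ∈ S) (hs' : s' ∈ S) (hsc : dist s c ≤ 3) (hs'c : dist s' c ≤ 3) : v s = v s' := by
  have h0 : ‖v s - v s'‖ ^ 2 ≤ 0 := by
    refine le_of_forall_pos_le_add fun ε hε => ?_
    obtain ⟨m, hm⟩ := exists_oscAt_lt hfin hcard hbd hθ hθ1 hIP c (by positivity : 0 < ε / 4)
    have h1 : ‖v s - m‖ ^ 2 < ε / 4 := (norm_sub_sq_le_oscAt (hfin c 3) hs hsc m).trans_lt hm
    have h2 : ‖v s' - m‖ ^ 2 < ε / 4 := (norm_sub_sq_le_oscAt (hfin c 3) hs' hs'c m).trans_lt hm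
    have h3 : ‖v s - v s'‖ ≤ ‖v s - m‖ + ‖v s' - m‖ := by
      calc ‖v s - v s'‖ = ‖(v s - m) - (v s' - m)‖ := by rw [sub_sub_sub_cancel_right]
        _ ≤ ‖v s - m‖ + ‖v s' - m‖ := norm_sub_le _ _
    have h4 : ‖v s - v s'‖ ^ 2 ≤ (‖v s - m‖ + ‖v s' - m‖) ^ 2 :=
      pow_le_pow_left₀ (norm_nonneg _) h3 2
    nlinarith [sq_nonneg (‖v s - m‖ - ‖v s' - m‖)]
  have h5 : ‖v s - v s'‖ = 0 := by nlinarith [norm_nonneg (v s - v s')]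
  exact sub_eq_zero.1 (norm_eq_zero.1 h5)

/-- **Chaining.** If `v` is constant on every `S ∩ B_3(c)` and every point of space is within `2` of `S`, then
`v` takes the value `v s` at every site within `2` of the points `s + k • e` (`‖e‖ ≤ 1`, `k ∈ ℕ`) of a chain
started at the site `s`. [folklore] -/
theorem eq_of_chain
    (hloc : ∀ c s s' : EuclideanSpace ℝ (Fin 3), s ∈ S → s' ∈ S → dist s c ≤ 3 → dist s' c ≤ 3 → v s = v s')
    (hcov : ∀ c : EuclideanSpace ℝ (Fin 3), ∃ s ∈ S, dist s c ≤ 2) {s : EuclideanSpace ℝ (Fin 3)}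
    (hs : s ∈ S) {e : EuclideanSpace ℝ (Fin 3)} (he : ‖e‖ ≤ 1) :
    ∀ (k : ℕ), ∀ q ∈ S, dist q (s + (k : ℝ) • e) ≤ 2 → v q = v s := by
  intro k
  induction k with
  | zero =>
    intro q hq hqd
    rw [Nat.cast_zero, zero_smul, add_zero] at hqd
    exact hloc s q s hq hs (by linarith) (by rw [dist_self]; norm_num)
  | succ k ih =>
    intro q hq hqd
    obtain ⟨q₀, hq₀, hq₀d⟩ := hcov (s + (k : ℝ) • e)
    have h1 : v q₀ = v s := ih q₀ hq₀ hq₀d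
    have hstep : dist (s + (k : ℝ) • e) (s + ((k + 1 : ℕ) : ℝ) • e) ≤ 1 := by
      have h : (s + (k : ℝ) • e) - (s + ((k + 1 : ℕ) : ℝ) • e) = -e := by
        push_cast
        module
      rw [dist_eq_norm, h, norm_neg]
      exact he
    have h2 : dist q₀ (s + ((k + 1 : ℕ) : ℝ) • e) ≤ 3 := by
      linarith [dist_triangle q₀ (s + (k : ℝ) • e) (s + ((k + 1 : ℕ) : ℝ) • e)]
    rw [← h1]
    exact hloc _ q q₀ hq hq₀ (by linarith) h2

/-- **Globalisation.** Local constancy on all balls of radius `3` plus covering radius `2` make `v` constant on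
`S` (chain the balls along the segment from `s` to `s'` in steps of length `≤ 1`). [folklore] -/
theorem eq_of_local
    (hloc : ∀ c s s' : EuclideanSpace ℝ (Fin 3), s ∈ S → s' ∈ S → dist s c ≤ 3 → dist s' c ≤ 3 → v s = v s')
    (hcov : ∀ c : EuclideanSpace ℝ (Fin 3), ∃ s ∈ S, dist s c ≤ 2) {s s' : EuclideanSpace ℝ (Fin 3)}
    (hs : s ∈ S) (hs' : s' ∈ S) : v s = v s' := by
  obtain ⟨N, hN⟩ := exists_nat_gt (dist s s')
  have hN0 : (0 : ℝ) < N := dist_nonneg.trans_lt hN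
  have he : ‖(N : ℝ)⁻¹ • (s' - s)‖ ≤ 1 := by
    rw [norm_smul, norm_inv, Real.norm_natCast, ← dist_eq_norm, dist_comm, inv_mul_le_iff₀ hN0, mul_one]
    exact hN.le
  have hend : s + (N : ℝ) • ((N : ℝ)⁻¹ • (s' - s)) = s' := by
    rw [smul_smul, mul_inv_cancel₀ hN0.ne', one_smul]
    abel
  exact (eq_of_chain hloc hcov hs he N s' hs' (by rw [hend, dist_self]; norm_num)).symm

end Iteration

end Blowdown

/-- **Stub `stub_iteration` of skeleton v4** (crux stmt-AtomisticToContinuum-9332, line `Sketch`): an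
improvement-of-flatness step valid at all large scales forces a bounded field on a locally finite, relatively
dense site set to be constant (pure real analysis: ladder from `R = ∞`, smallness on fixed balls, local
constancy, chaining). [folklore] -/
theorem stub_iteration :
    ∀ (S : Set (EuclideanSpace ℝ (Fin 3))) (v : EuclideanSpace ℝ (Fin 3) → EuclideanSpace ℝ (Fin 3))
      (θ R₀ K : ℝ),
      (∀ (c : EuclideanSpace ℝ (Fin 3)) (r : ℝ),
        Set.Finite {s : EuclideanSpace ℝ (Fin 3) | s ∈ S ∧ dist s c ≤ r}) →
      (∀ (c : EuclideanSpace ℝ (Fin 3)) (r : ℝ), 1 ≤ r → ∀ F : Finset (EuclideanSpace ℝ (Fin 3)),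
        (∀ s ∈ F, s ∈ S ∧ dist s c ≤ r) → (F.card : ℝ) ≤ 32 * r ^ 3) →
      (∀ c : EuclideanSpace ℝ (Fin 3), ∃ s ∈ S, dist s c ≤ 2) → (∀ s ∈ S, ‖v s‖ ≤ 3 / 40) →
      0 < θ → θ < 1 → 1 ≤ R₀ → Blowdown.ImprovementProp θ R₀ K S v →
        ∃ m : EuclideanSpace ℝ (Fin 3), ∀ s ∈ S, v s = m := by
  intro S v θ R₀ K hfin hcard hcov hbd hθ hθ1 _ hIP
  by_cases hS : ∃ s₀, s₀ ∈ S
  · obtain ⟨s₀, hs₀⟩ := hS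
    exact ⟨v s₀, fun s hs => Blowdown.eq_of_local
      (fun c s s' hs hs' => Blowdown.eq_of_dist_le_three hfin hcard hbd hθ hθ1 hIP c hs hs') hcov hs hs₀⟩
  · exact ⟨0, fun s hs => (hS ⟨s, hs⟩).elim⟩

end Summit.AtomisticToContinuum.Crystallization.Theorems.ExcessDecayLiouville

end
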